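import Summits.QuantumFields.BalabanUV.Beta.CombRemainderParityAll

/-!
# `BalabanUV.Gaps.D1CumJcFree` — cell `pub-balaban-gaps` (YM blitz Y1), track G1 binder (D1), seat g1-p1 LANDING g1-plan-2's skeleton **SK-D1c**
# (`HOME/g1/skeletons/SKD1c_D1CumJcFree.lean` v2 616d46648e8c3a63, lens structural ∕ reformulation, PARTS A, A′, B verbatim modulo inlining; PART C's
# `stub_window` CLOSED, `stub_D1Cum` = THE WALL left DISPLAYED) plus the exact read-out identity from `D1Tel` and the record-literal ENDs:
# **(D1) AT END GRADE FACTORS THROUGH ONE SCALAR, `Jc`-FREE STATEMENT (D1Cum), AND (D1) ⟺ (D1Cum) MODULO THE TWO PRINTED [B5] STATEMENTS BY NAME**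

HONEST FRAMING (page 1, cell contract).  A REFORMULATION of binder (D1) at END grade, kernel-checked against the tree's own seam; NOTHING of Bałaban's is
asserted beyond print; (D1Cum) below is a HYPOTHESIS SHAPE (written INLINE as an `∃`-clause; NAMED `D1Cum` in the companion statement file
`Gaps/D1Residue.lean`), never a fact — for Bałaban's stencils it is the located UNPRINTED one-loop content behind [B12] Theorem 2 (T. Bałaban, CMP 109 (1987),
p. 259, printed WITHOUT proof; [B16] p. 355 «has not been published yet»); NOT D1, NOT `BetaPertH`, NOT continuum, NOT Clay.
HONEST DEPENDENCY (verbatim): continuum YM on T⁴ ⇐ BetaPertH ∧ nine spine estimates (0/9 proved); BetaPertH ⇐ (D1) ∧ (D4) ∧ CAP+tail; G-an2-4 gates asym, D1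
and NE2/3/4.

WHAT IT SHOWS (g1-plan-2, ROUTES-PLAN-2 §1.2).  The tree's (D1) road `D1Tel ∧ D1Rep ⟹ D1Drift` (`OneStepKernelFamily.d1Drift_of_D1Tel_D1Rep`) passes through ONE scalar
statement mentioning NEITHER the composite jets `Jc` NOR the one-shot kernels `TshotOf` NOR the coarse tensors:
  (D1Cum)  `∃ U, ∀ m ≥ 1, |Σ_{j<m} β⁰_j − oneShotSide SL μ ν N a k (Lc^m)| ≤ U`,  `β⁰_j := secondMoment (TbalOf Lc Js j) μ ν`
— the partial sums of the one-loop coefficients track the FREE infinite-volume one-shot sums (`ScalewiseVectorSeam.oneShotSide`) at the blocking scales `Lc^m`,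
uniformly in `m`.
* §1 PART A `d1Drift_of_d1Cum`: (D1Cum) ⟹ (D1) for ANY step jets, from the two PRINTED [B5] statements BY NAME (`h12`, `h126` — cited upstream, displayed, NOT
  proved) + labels + window; NO Ward ∕ reflection ∕ decay binder, NO composite jets (`ScalewiseVectorSeam.oneLoopDrift_of_vectorTails_evenVolume`).
  PART A′ `d1Cum_of_d1Drift`: the converse by the free-bubble drift `oneShotSide_drift` — so (D1) ⟺ (D1Cum) modulo [B5] BY NAME (`d1Drift_iff_d1Cum`): the
  PRINTED input of (D1) is EXACTLY the free-bubble asymptotics; the UNPRINTED content is (D1Cum).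
* §2 PART B `d1Cum_of_D1Tel_D1Rep`: nothing is lost — `D1Tel ∧ D1Rep (+ hW, hR)` ⟹ (D1Cum) (`scalewiseData_of_printed_flip`, `hU_of_scalewise`); and its
  `O(1)`-tolerant, symmetry-free twin `d1Cum_of_readoutBdd_D1Rep` ((RB) bounded read-out defect ∧ `D1Rep` ⟹ (D1Cum), pure triangle inequality); and the EXACT
  READ-OUT IDENTITY `readout_eq_of_D1Tel` (`D1Tel` + hW + hR ⟹ `Σ_{j<m} β⁰_j = secondMoment (TshotOf Lc Jc m) μ ν` for `m ≥ 1`, hence (RB) with `U′ = 0`,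
  `readoutBdd_of_D1Tel`).
* §3 PART C at ROOT M‴'s PINNED jets `JsB12CombShSym hLc N (symTablesAn1S2 3 Lc (2/Lc⁴)) (2/Lc⁴) (−Lc¹²/4)` (locks instantiated) with the window `M := id`, `cc := 1`
  (`stub_window` CLOSED): `d1Drift_record_of_d1Cum` ((D1Cum) for the record coefficients + printed [B5] + labels ⟹ (D1) — the record END in the Jc-free currency,
  displaying exactly ONE unprinted clause), `d1Cum_record_of_D1Tel_D1Rep` (ROOT M‴ read in this currency: `D1Tel ∧ D1Rep` ⟹ (D1Cum), no symmetry letter displayed),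
  `d1Drift_record_iff_d1Cum`.
What (D1Cum) is NOT: not pointwise `β⁰_k ≈ stepBal` (rigid for history-independent targets, `BetaPertRigid`); not (D1) itself; not printed.  `stub_D1Cum` of the
skeleton — (D1Cum) for the record jets — is THE WALL (EXIT-A of the β sub-cell, road BF-x) and is displayed as the hypothesis `hcum`, proved nowhere.

Nothing below is cited; no `def`, no `Prop` minted; no `sorry`; axioms ⊆ the standard trio.  Provenance: cell pub-balaban-gaps, seat g1-p1 over g1-plan-2's SK-D1c,
2026-08-22; imports ROOT M‴ `Beta.CombRemainderParityAll` only; no existing file touched.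
-/

noncomputable section

open Finset
open scoped BigOperators
open Literature.MathematicalPhysics.QuantumFieldTheory
open Literature.MathematicalPhysics.QuantumFieldTheory.Balaban1983to89
open Literature.MathematicalPhysics.QuantumFieldTheory.Balaban1983to89.Beta
open OneStepResolventKernel (JetData)
open OneStepKernelFamily (TbalOf TshotOf D1Tel D1Rep D1Drift flipK hdec_TbalOf)
open B12Beta (secondMoment)
open DressedMomentNormalisation (EKer m2Tensor)
open ScalewiseVectorSeam (oneShotSide oneShotSide_drift oneLoopDrift_of_vectorTails_evenVolume splitOf scalewiseData_of_printed_flip hU_of_scalewise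
  readout122 readout122_add readout122_m2Tensor oneShotFullSum_readout122_iff)
open MarginalTelescoping (composedCoeff)
open HidentScalewise (identityForm_trivial composedCoeff_trivial flowSum_eq_oneShotReadout)
open PolarizationSign (WardTransversal AxisReflectionCovariant)
open VectorTailsLoc (fam kfam)
open VectorLegVolumeAdapter (MvE)
open Summit.QuantumFields.BalabanUV.Beta.CombChartJointEnd (JsB12CombShSym)
open Summit.QuantumFields.BalabanUV.Beta.SymSecondOrderTablesAn1 (symTablesAn1S2)
open Summit.QuantumFields.BalabanUV.Beta.CombRemainderParityAll (d1Drift_JsB12CombShSym_an1TablesS2_pinned_of_locks_D1Tel_D1Rep)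

namespace Summit.QuantumFields.BalabanUV.Gaps.D1CumJcFree

variable {Lc : ℕ} [NeZero Lc] {L : Type*}

/-! ## §1 PART A / A′ — (D1Cum) ⟺ (D1) modulo the two printed [B5] statements, for ANY step jets -/

/-- [folklore] **PART A (g1-plan-2 SK-D1c): (D1Cum) ⟹ (D1)** for the one-loop coefficients of ANY step jet data `Js`: the two PRINTED [B5] statements BY NAME,
base-point labels, the window data and (D1Cum) give the drift with slope `stepBal N Lc`; NO Ward ∕ reflection ∕ decay binder, NO composite jets. -/
theorem d1Drift_of_d1Cum (a : ℝ) (ha : 0 < a)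
    (h12 : B5.Prop12Printed (fam (fun i : ℕ+ × ℕ => ((i.1 : ℕ+) : ℕ)) (fun i => i.1.pos) MvE a ha))
    (h126 : B5.Kernel126_127Printed (kfam (fun i : ℕ+ × ℕ => ((i.1 : ℕ+) : ℕ)) MvE))
    {SL : Finset L} (hSL : SL.Nonempty) (k : L → Fin 4) {μ ν : Fin 4} (hμν : μ ≠ ν) {N : ℝ} (hN : N ≠ 0) (hL : 2 ≤ Lc) (Js : ℕ → JetData 3 Lc)
    {cc : ℝ} {M : ℕ → ℕ} (hc : 1 ≤ cc) (hM : ∀ L : ℕ, 2 ≤ L → 1 ≤ M L ∧ (L : ℝ) ≤ cc * M L) (hML : ∀ L : ℕ, 2 ≤ L → M L ≤ L)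
    (hcum : ∃ U : ℝ, ∀ m : ℕ, 1 ≤ m → |∑ j ∈ range m, secondMoment (TbalOf Lc Js j) μ ν - oneShotSide SL μ ν N a k (Lc ^ m)| ≤ U) :
    D1Drift Lc Js N μ ν := by
  obtain ⟨U, hU⟩ := hcum
  exact oneLoopDrift_of_vectorTails_evenVolume a ha h12 h126 hSL k (splitOf fun j => secondMoment (TbalOf Lc Js j) μ ν)
    hμν hN hL (μC := fun j _ => secondMoment (TbalOf Lc Js j) μ ν) hc hM hML (fun m hm => by rw [composedCoeff_trivial]; exact hU m hm)
    (identityForm_trivial fun j => secondMoment (TbalOf Lc Js j) μ ν)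

/-- [folklore] **PART A′ (g1-plan-2 SK-D1c): (D1) ⟹ (D1Cum)** by the FREE-BUBBLE DRIFT `oneShotSide_drift` under the same printed [B5] statements BY NAME. -/
theorem d1Cum_of_d1Drift (a : ℝ) (ha : 0 < a)
    (h12 : B5.Prop12Printed (fam (fun i : ℕ+ × ℕ => ((i.1 : ℕ+) : ℕ)) (fun i => i.1.pos) MvE a ha))
    (h126 : B5.Kernel126_127Printed (kfam (fun i : ℕ+ × ℕ => ((i.1 : ℕ+) : ℕ)) MvE))
    {SL : Finset L} (hSL : SL.Nonempty) (k : L → Fin 4) {μ ν : Fin 4} (hμν : μ ≠ ν) {N : ℝ} (hN : N ≠ 0) (hL : 2 ≤ Lc) (Js : ℕ → JetData 3 Lc)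
    {cc : ℝ} {M : ℕ → ℕ} (hc : 1 ≤ cc) (hM : ∀ L : ℕ, 2 ≤ L → 1 ≤ M L ∧ (L : ℝ) ≤ cc * M L) (hML : ∀ L : ℕ, 2 ≤ L → M L ≤ L)
    (h : D1Drift Lc Js N μ ν) :
    ∃ U : ℝ, ∀ m : ℕ, 1 ≤ m → |∑ j ∈ range m, secondMoment (TbalOf Lc Js j) μ ν - oneShotSide SL μ ν N a k (Lc ^ m)| ≤ U := by
  obtain ⟨A, hA⟩ := h
  obtain ⟨A', hA'⟩ := oneShotSide_drift a ha h12 h126 hSL k hμν hN hL hc hM hML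
  refine ⟨A + A' + |oneShotSide SL μ ν N a k (Lc ^ 0)|, fun m _ => ?_⟩
  have e : ∑ j ∈ range m, secondMoment (TbalOf Lc Js j) μ ν - oneShotSide SL μ ν N a k (Lc ^ m)
      = (∑ j ∈ range m, secondMoment (TbalOf Lc Js j) μ ν - B12Normalization.stepBal N Lc * m)
        - (oneShotSide SL μ ν N a k (Lc ^ m) - oneShotSide SL μ ν N a k (Lc ^ 0) - B12Normalization.stepBal N Lc * m)
        - oneShotSide SL μ ν N a k (Lc ^ 0) := by ring
  rw [e]
  exact (abs_sub _ _).trans (add_le_add ((abs_sub _ _).trans (add_le_add (hA m) (hA' m))) le_rfl)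

/-- [folklore] **(D1) ⟺ (D1Cum) MODULO THE TWO PRINTED [B5] STATEMENTS BY NAME** (any step jets; labels, window, `μ ≠ ν`, `N ≠ 0`, `2 ≤ Lc`): the PRINTED input of (D1)
is exactly the free-bubble asymptotics, the UNPRINTED content is (D1Cum). -/
theorem d1Drift_iff_d1Cum (a : ℝ) (ha : 0 < a)
    (h12 : B5.Prop12Printed (fam (fun i : ℕ+ × ℕ => ((i.1 : ℕ+) : ℕ)) (fun i => i.1.pos) MvE a ha))
    (h126 : B5.Kernel126_127Printed (kfam (fun i : ℕ+ × ℕ => ((i.1 : ℕ+) : ℕ)) MvE))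
    {SL : Finset L} (hSL : SL.Nonempty) (k : L → Fin 4) {μ ν : Fin 4} (hμν : μ ≠ ν) {N : ℝ} (hN : N ≠ 0) (hL : 2 ≤ Lc) (Js : ℕ → JetData 3 Lc)
    {cc : ℝ} {M : ℕ → ℕ} (hc : 1 ≤ cc) (hM : ∀ L : ℕ, 2 ≤ L → 1 ≤ M L ∧ (L : ℝ) ≤ cc * M L) (hML : ∀ L : ℕ, 2 ≤ L → M L ≤ L) :
    D1Drift Lc Js N μ ν ↔
      ∃ U : ℝ, ∀ m : ℕ, 1 ≤ m → |∑ j ∈ range m, secondMoment (TbalOf Lc Js j) μ ν - oneShotSide SL μ ν N a k (Lc ^ m)| ≤ U :=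
  ⟨d1Cum_of_d1Drift a ha h12 h126 hSL k hμν hN hL Js hc hM hML, d1Drift_of_d1Cum a ha h12 h126 hSL k hμν hN hL Js hc hM hML⟩

/-! ## §2 PART B — nothing is lost: the tree's road factors through (D1Cum); the exact read-out identity from `D1Tel` -/

/-- [folklore] **THE EXACT READ-OUT IDENTITY**: Hessian telescoping `D1Tel` onto a composite family `Jc` plus the printed Ward ∕ reflection properties of the
flipped step kernels (decay discharged by `hdec_TbalOf`) give `Σ_{j<m} secondMoment (TbalOf Lc Js j) μ ν = secondMoment (TshotOf Lc Jc m) μ ν` for every `m ≥ 1`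
(`scalewiseData_of_printed_flip` + `HidentScalewise.flowSum_eq_oneShotReadout` at the (1.22) read-out). -/
theorem readout_eq_of_D1Tel (Js : ℕ → JetData 3 Lc) (Jc : ∀ m : ℕ, JetData 3 (Lc ^ m))
    (hW : ∀ j, WardTransversal (flipK (TbalOf Lc Js j))) (hR : ∀ j, AxisReflectionCovariant (flipK (TbalOf Lc Js j)))
    (htel : D1Tel Lc Js Jc) (μ ν : Fin 4) {m : ℕ} (hm : 1 ≤ m) :
    ∑ j ∈ range m, secondMoment (TbalOf Lc Js j) μ ν = secondMoment (TshotOf Lc Jc m) μ ν := by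
  obtain ⟨hTA, hT0, hT1⟩ := scalewiseData_of_printed_flip (hdec_TbalOf Js) hW hR
  have hβ' : ∀ j, secondMoment (TbalOf Lc Js j) μ ν = readout122 μ ν (m2Tensor (TbalOf Lc Js j)) := fun j => by
    rw [readout122_m2Tensor]
  rw [flowSum_eq_oneShotReadout hTA hT0 hT1 htel (readout122_add μ ν) hβ' hm, readout122_m2Tensor]

/-- [folklore] **`D1Tel` (+ hW, hR) ⟹ (RB) with `U′ = 0`**: exact telescoping gives the bounded (indeed vanishing) cumulative read-out defect. -/
theorem readoutBdd_of_D1Tel (Js : ℕ → JetData 3 Lc) (Jc : ∀ m : ℕ, JetData 3 (Lc ^ m))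
    (hW : ∀ j, WardTransversal (flipK (TbalOf Lc Js j))) (hR : ∀ j, AxisReflectionCovariant (flipK (TbalOf Lc Js j)))
    (htel : D1Tel Lc Js Jc) (μ ν : Fin 4) :
    ∃ U' : ℝ, ∀ m : ℕ, 1 ≤ m → |∑ j ∈ range m, secondMoment (TbalOf Lc Js j) μ ν - secondMoment (TshotOf Lc Jc m) μ ν| ≤ U' :=
  ⟨0, fun m hm => by rw [readout_eq_of_D1Tel Js Jc hW hR htel μ ν hm, sub_self, abs_zero]⟩

/-- [folklore] **PART B (g1-plan-2 SK-D1c): `D1Tel ∧ D1Rep (+ hW, hR)` ⟹ (D1Cum)** — the tree's road factors through (D1Cum); nothing is lost. -/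
theorem d1Cum_of_D1Tel_D1Rep (Js : ℕ → JetData 3 Lc) (Jc : ∀ m : ℕ, JetData 3 (Lc ^ m))
    (hW : ∀ j, WardTransversal (flipK (TbalOf Lc Js j))) (hR : ∀ j, AxisReflectionCovariant (flipK (TbalOf Lc Js j)))
    (htel : D1Tel Lc Js Jc) {N : ℝ} {μ ν : Fin 4} {a : ℝ} {SL : Finset L} {k : L → Fin 4} (hrep : D1Rep Lc Jc N μ ν a SL k) :
    ∃ U : ℝ, ∀ m : ℕ, 1 ≤ m → |∑ j ∈ range m, secondMoment (TbalOf Lc Js j) μ ν - oneShotSide SL μ ν N a k (Lc ^ m)| ≤ U := by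
  obtain ⟨U, hU⟩ := hrep
  exact ⟨U, fun m hm => by rw [readout_eq_of_D1Tel Js Jc hW hR htel μ ν hm]; exact hU m hm⟩

/-- [folklore] **(RB) ∧ `D1Rep` ⟹ (D1Cum)** — the `O(1)`-tolerant, symmetry-free twin of PART B (pure triangle inequality; no printed input). -/
theorem d1Cum_of_readoutBdd_D1Rep (Js : ℕ → JetData 3 Lc) (Jc : ∀ m : ℕ, JetData 3 (Lc ^ m)) {N : ℝ} {μ ν : Fin 4} {a : ℝ} {SL : Finset L}
    {k : L → Fin 4}
    (hbdd : ∃ U' : ℝ, ∀ m : ℕ, 1 ≤ m → |∑ j ∈ range m, secondMoment (TbalOf Lc Js j) μ ν - secondMoment (TshotOf Lc Jc m) μ ν| ≤ U')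
    (hrep : D1Rep Lc Jc N μ ν a SL k) :
    ∃ U : ℝ, ∀ m : ℕ, 1 ≤ m → |∑ j ∈ range m, secondMoment (TbalOf Lc Js j) μ ν - oneShotSide SL μ ν N a k (Lc ^ m)| ≤ U := by
  obtain ⟨U', hU'⟩ := hbdd
  obtain ⟨U, hU⟩ := hrep
  refine ⟨U' + U, fun m hm => ?_⟩
  have e : ∑ j ∈ range m, secondMoment (TbalOf Lc Js j) μ ν - oneShotSide SL μ ν N a k (Lc ^ m)
      = (∑ j ∈ range m, secondMoment (TbalOf Lc Js j) μ ν - secondMoment (TshotOf Lc Jc m) μ ν)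
        + (secondMoment (TshotOf Lc Jc m) μ ν - oneShotSide SL μ ν N a k (Lc ^ m)) := by ring
  rw [e]
  exact (abs_add_le _ _).trans (add_le_add (hU' m hm) (hU m hm))

/-- [folklore] **(D1Cum) ∧ (RB) ⟹ `D1Rep`** — the composite family's representation binder recovered from the scalar (pure triangle inequality). -/
theorem d1Rep_of_d1Cum_readoutBdd (Js : ℕ → JetData 3 Lc) (Jc : ∀ m : ℕ, JetData 3 (Lc ^ m)) {N : ℝ} {μ ν : Fin 4} {a : ℝ} {SL : Finset L}
    {k : L → Fin 4}
    (hcum : ∃ U : ℝ, ∀ m : ℕ, 1 ≤ m → |∑ j ∈ range m, secondMoment (TbalOf Lc Js j) μ ν - oneShotSide SL μ ν N a k (Lc ^ m)| ≤ U)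
    (hbdd : ∃ U' : ℝ, ∀ m : ℕ, 1 ≤ m → |∑ j ∈ range m, secondMoment (TbalOf Lc Js j) μ ν - secondMoment (TshotOf Lc Jc m) μ ν| ≤ U') :
    D1Rep Lc Jc N μ ν a SL k := by
  obtain ⟨U, hU⟩ := hcum
  obtain ⟨U', hU'⟩ := hbdd
  refine ⟨U + U', fun m hm => ?_⟩
  have e : secondMoment (TshotOf Lc Jc m) μ ν - oneShotSide SL μ ν N a k (Lc ^ m)
      = (∑ j ∈ range m, secondMoment (TbalOf Lc Js j) μ ν - oneShotSide SL μ ν N a k (Lc ^ m))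
        - (∑ j ∈ range m, secondMoment (TbalOf Lc Js j) μ ν - secondMoment (TshotOf Lc Jc m) μ ν) := by ring
  rw [e]
  exact (abs_sub _ _).trans (add_le_add (hU m hm) (hU' m hm))

/-! ## §3 PART C — at ROOT M‴'s PINNED jets, locks and window instantiated (`stub_window` closed; `stub_D1Cum` = THE WALL, displayed as `hcum`) -/

omit [NeZero Lc] in
/-- [folklore] The first lock at its value: `(2/Lc⁴)·Lc⁴ = 2` for `2 ≤ Lc`. -/
private theorem lock_mul_pow (hL2 : 2 ≤ Lc) : 2 / (Lc : ℝ) ^ 4 * (Lc : ℝ) ^ 4 = 2 := by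
  have hLc : (Lc : ℝ) ≠ 0 := by
    have : (0 : ℝ) < Lc := by exact_mod_cast (by omega : 0 < Lc)
    exact this.ne'
  field_simp

/-- [folklore] SK-D1c's `stub_window`, CLOSED: the window `M := id`, `cc := 1` meets the window clauses. -/
theorem window_id : (1 : ℝ) ≤ 1 ∧ (∀ Lw : ℕ, 2 ≤ Lw → 1 ≤ (fun n : ℕ => n) Lw ∧ (Lw : ℝ) ≤ 1 * ((fun n : ℕ => n) Lw : ℕ)) ∧
    (∀ Lw : ℕ, 2 ≤ Lw → (fun n : ℕ => n) Lw ≤ Lw) := by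
  refine ⟨le_rfl, fun Lw hLw => ⟨?_, by simp⟩, fun _ _ => le_rfl⟩
  show 1 ≤ Lw
  omega

/-- [folklore] **THE RECORD END IN THE Jc-FREE CURRENCY** (SK-D1c PART C with `stub_window` closed): at the step jets of record
`JsB12CombShSym hLc N (symTablesAn1S2 3 Lc cΛ) cΛ cB` (ANY table parameters — in this currency no lock is consumed), (D1Cum) for their one-loop coefficients + the two
PRINTED [B5] statements BY NAME + labels + `μ ≠ ν`, `Nc ≠ 0`, `2 ≤ Lc` ⟹ (D1).  EXACTLY ONE unprinted clause is displayed: `hcum` (= SK-D1c's `stub_D1Cum`, THE WALL). -/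
theorem d1Drift_record_of_d1Cum (hLc : Odd Lc) (hL2 : 2 ≤ Lc) (N : ℕ) (cΛ cB : ℝ) (a : ℝ) (ha : 0 < a)
    (h12 : B5.Prop12Printed (fam (fun i : ℕ+ × ℕ => ((i.1 : ℕ+) : ℕ)) (fun i => i.1.pos) MvE a ha))
    (h126 : B5.Kernel126_127Printed (kfam (fun i : ℕ+ × ℕ => ((i.1 : ℕ+) : ℕ)) MvE))
    {SL : Finset L} (hSL : SL.Nonempty) (k : L → Fin 4) {μ ν : Fin 4} (hμν : μ ≠ ν) {Nc : ℝ} (hNc : Nc ≠ 0)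
    (hcum : ∃ U : ℝ, ∀ m : ℕ, 1 ≤ m →
      |∑ j ∈ range m, secondMoment (TbalOf Lc (JsB12CombShSym hLc N (symTablesAn1S2 3 Lc cΛ) cΛ cB) j) μ ν - oneShotSide SL μ ν Nc a k (Lc ^ m)| ≤ U) :
    D1Drift Lc (JsB12CombShSym hLc N (symTablesAn1S2 3 Lc cΛ) cΛ cB) Nc μ ν :=
  d1Drift_of_d1Cum a ha h12 h126 hSL k hμν hNc hL2 _ (M := fun n => n) window_id.1 window_id.2.1 window_id.2.2 hcum

/-- [folklore] **ROOT M‴ READ IN THE Jc-FREE CURRENCY**: at the PINNED jets (locks `cΛ := 2/Lc⁴`, `cB := −Lc¹²/4` instantiated), `D1Tel` onto composite jets `Jc` ∧ `D1Rep`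
for them ∧ the two PRINTED [B5] statements BY NAME ∧ labels ∧ `μ ≠ ν`, `Nc ≠ 0`, `Odd Lc`, `2 ≤ Lc`, `2 ≤ N` ⟹ (D1Cum) for the record coefficients — ROOT M‴ followed by
PART A′; NO symmetry letter is displayed (hW ∕ hR are discharged inside ROOT M‴). -/
theorem d1Cum_record_of_D1Tel_D1Rep (hLc : Odd Lc) (hL2 : 2 ≤ Lc) {N : ℕ} (hN : 2 ≤ N) (a : ℝ) (ha : 0 < a)
    (h12 : B5.Prop12Printed (fam (fun i : ℕ+ × ℕ => ((i.1 : ℕ+) : ℕ)) (fun i => i.1.pos) MvE a ha))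
    (h126 : B5.Kernel126_127Printed (kfam (fun i : ℕ+ × ℕ => ((i.1 : ℕ+) : ℕ)) MvE))
    {SL : Finset L} (hSL : SL.Nonempty) (k : L → Fin 4) {μ ν : Fin 4} (hμν : μ ≠ ν) {Nc : ℝ} (hNc : Nc ≠ 0)
    (Jc : ∀ m : ℕ, JetData 3 (Lc ^ m))
    (htel : D1Tel Lc (JsB12CombShSym hLc N (symTablesAn1S2 3 Lc (2 / (Lc : ℝ) ^ 4)) (2 / (Lc : ℝ) ^ 4) (-((Lc : ℝ) ^ 12 / 4))) Jc)
    (hrep : D1Rep Lc Jc Nc μ ν a SL k) :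
    ∃ U : ℝ, ∀ m : ℕ, 1 ≤ m →
      |∑ j ∈ range m, secondMoment (TbalOf Lc (JsB12CombShSym hLc N (symTablesAn1S2 3 Lc (2 / (Lc : ℝ) ^ 4)) (2 / (Lc : ℝ) ^ 4) (-((Lc : ℝ) ^ 12 / 4))) j) μ ν
        - oneShotSide SL μ ν Nc a k (Lc ^ m)| ≤ U :=
  d1Cum_of_d1Drift a ha h12 h126 hSL k hμν hNc hL2 _ (M := fun n => n) window_id.1 window_id.2.1 window_id.2.2
    (d1Drift_JsB12CombShSym_an1TablesS2_pinned_of_locks_D1Tel_D1Rep hLc hL2 hN (2 / (Lc : ℝ) ^ 4) (-((Lc : ℝ) ^ 12 / 4)) (lock_mul_pow hL2) rfl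
      a ha h12 h126 hSL k hμν hNc Jc htel (cc := 1) (Mw' := fun n => n) le_rfl window_id.2.1 window_id.2.2 hrep)

/-- [folklore] **(D1) ⟺ (D1Cum) AT THE LITERAL OF RECORD, MODULO THE TWO PRINTED [B5] STATEMENTS BY NAME** (any table parameters; window instantiated). -/
theorem d1Drift_record_iff_d1Cum (hLc : Odd Lc) (hL2 : 2 ≤ Lc) (N : ℕ) (cΛ cB : ℝ) (a : ℝ) (ha : 0 < a)
    (h12 : B5.Prop12Printed (fam (fun i : ℕ+ × ℕ => ((i.1 : ℕ+) : ℕ)) (fun i => i.1.pos) MvE a ha))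
    (h126 : B5.Kernel126_127Printed (kfam (fun i : ℕ+ × ℕ => ((i.1 : ℕ+) : ℕ)) MvE))
    {SL : Finset L} (hSL : SL.Nonempty) (k : L → Fin 4) {μ ν : Fin 4} (hμν : μ ≠ ν) {Nc : ℝ} (hNc : Nc ≠ 0) :
    D1Drift Lc (JsB12CombShSym hLc N (symTablesAn1S2 3 Lc cΛ) cΛ cB) Nc μ ν ↔
      ∃ U : ℝ, ∀ m : ℕ, 1 ≤ m →
        |∑ j ∈ range m, secondMoment (TbalOf Lc (JsB12CombShSym hLc N (symTablesAn1S2 3 Lc cΛ) cΛ cB) j) μ ν - oneShotSide SL μ ν Nc a k (Lc ^ m)| ≤ U :=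
  d1Drift_iff_d1Cum a ha h12 h126 hSL k hμν hNc hL2 _ (M := fun n => n) window_id.1 window_id.2.1 window_id.2.2

end Summit.QuantumFields.BalabanUV.Gaps.D1CumJcFree

end
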